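import Mathlib
import Summits.NavierStokesRegularity.NavierStokesRegularity.Theorems.HeteroclinicTriggerChainTriggerChainFrontStepCarrierRow
import Summits.NavierStokesRegularity.NavierStokesRegularity.Theorems.HeteroclinicTriggerChainTriggerChainFrontStepTriggerRow
import Summits.NavierStokesRegularity.NavierStokesRegularity.Theorems.HeteroclinicTriggerChainTriggerChainFrontStepForcedArcWithin
import HarnessLib

/-!
# `HeteroclinicTriggerChain` — crux `TriggerChainFrontStep` (item stmt-NavierStokesRegularity-22785):
  CAPTURE ON THE LATTICE — the front block of an exact flow of the pinned table is a forced arc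

First lattice-level dynamical statement of line `gapdata_v2` (blueprint item 2 composed with the row
formulas). Let `α₀` be in normal form at the diagonal pure-mode saddle `i₀` (symmetric, cancelling, pure
`i₀`-families force-free, diagonal polarisation `d`), with the (parity) clause for the trigger `i₁ ≠ i₀`,
the complete-transfer tuning `g := α₀ i₁ i₁ i₀ (0,0,1) = e := d i₁ 0 > 0` (forced by the connection, tree
file `…ConnectionForm`), and entries of modulus `≤ 1`; let `σ` be any second table and `β ≥ 0`. For a
family `S` solving the EXACT lattice equations of the pinned table `α₀ + βσ` on a window `[0,T]`
(`S_{i,k}′ = quadTerm 1 α₀ S i k + β·quadTerm 1 σ S i k`, derivatives within the segment — the regularity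
of `TaoCascade.PseudoFlowOn`), the front block `D = S_{i₀,0} − S_{i₀,1}`, `u = S_{i₁,0}` obeys
`D′ = −2e·u² + f₁`, `u′ = e·D·u + f₂` where, by `htcCR_quadTerm_carrier_zero/one` and
`htcTR_quadTerm_trigger`, the remainders are controlled by ENVELOPES of the other coordinates on the
window: junk modes (`∉ {i₀,i₁}`) at shells `−1, 0, 1` bounded by `ι`, the upper trigger `S_{i₁,1}` by
`V`, the wake trigger `S_{i₁,−1}` by `ω`, the three `σ`-rows by `B_σ`, and `|D|, |u| ≤ M`:
`|f₁|, |f₂| ≤ φ := 40ι² + 2ω² + 16V² + 8Mι + 4Vι + 4ωι + 3βB_σ` (`htcLC_front_block_forced`).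
Consequently (`htcLC_lattice_capture`) the receiver CAPTURES the energy — `S_{i₀,0} − S_{i₀,1} ≤ −L`
within `(D(0)+L)/(2em − φ)` — under the energy conditions of the forced-arc capture lemma
(`…ForcedArcWithin`). The wake CARRIERS never enter (`g_{i₀} = 0`: pure families are force-free), and
the carrier rows carry no back-reaction (`…CarrierRow`): this is why only `ι, V, ω, B_σ` appear.

HONEST FRAMING: a statement about exact flows of Tao-type MODEL lattices (Tao 2016 §4) under envelope
hypotheses that the line must supply elsewhere (tail/wake control); helper for the crux (no stub credit);
nothing here is a statement about the Navier–Stokes equations; no summit, rung or crux is proved.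
-/

noncomputable section

set_option linter.dupNamespace false

open Real Set

namespace Summit.NavierStokesRegularity.NavierStokesRegularity.Theorems

open Literature.Analysis.FluidPDE Literature.Analysis.FluidPDE.TaoCascade

/-- Splitting a sum over the four modes into the carrier term, the trigger term and a junk remainder
bounded by `2B` when each junk term is bounded by `B`. [folklore] -/
theorem htcLC_sum_split (F : Fin 4 → ℝ) {i₀ i₁ : Fin 4} (hne : i₀ ≠ i₁) {B : ℝ}
    (hB : ∀ a, a ≠ i₀ → a ≠ i₁ → |F a| ≤ B) :
    |∑ a, F a - F i₀ - F i₁| ≤ 2 * B := by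
  have h0 : ∑ a, F a = F i₀ + ∑ a ∈ Finset.univ.erase i₀, F a :=
    (Finset.add_sum_erase _ _ (Finset.mem_univ i₀)).symm
  have hi₁ : i₁ ∈ Finset.univ.erase i₀ := Finset.mem_erase.2 ⟨hne.symm, Finset.mem_univ _⟩
  have h1 : ∑ a ∈ Finset.univ.erase i₀, F a = F i₁ + ∑ a ∈ (Finset.univ.erase i₀).erase i₁, F a :=
    (Finset.add_sum_erase _ _ hi₁).symm
  have hcard : ((Finset.univ.erase i₀).erase i₁).card = 2 := by
    rw [Finset.card_erase_of_mem hi₁, Finset.card_erase_of_mem (Finset.mem_univ _), Finset.card_univ,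
      Fintype.card_fin]
  have hrest : |∑ a ∈ (Finset.univ.erase i₀).erase i₁, F a| ≤ 2 * B := by
    calc |∑ a ∈ (Finset.univ.erase i₀).erase i₁, F a|
        ≤ ∑ a ∈ (Finset.univ.erase i₀).erase i₁, |F a| := Finset.abs_sum_le_sum_abs _ _
      _ ≤ ∑ a ∈ (Finset.univ.erase i₀).erase i₁, B := Finset.sum_le_sum fun a ha => by
          have h := Finset.mem_erase.1 ha
          have h' := Finset.mem_erase.1 h.2
          exact hB a h'.1 h.1
      _ = 2 * B := by rw [Finset.sum_const, hcard, nsmul_eq_mul]; norm_num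
  have heq : ∑ a, F a - F i₀ - F i₁ = ∑ a ∈ (Finset.univ.erase i₀).erase i₁, F a := by
    rw [h0, h1]; ring
  rw [heq]
  exact hrest

/-- Bookkeeping inequality for the carrier-side remainder `f₁` of the front block. [folklore] -/
theorem htcLC_f1_abs_le {e c₁ c₂ R₁ R₂ R₃ R₄ w v Δ ι ω V β Bσ : ℝ} (he0 : 0 ≤ e) (he2 : e ≤ 2)
    (hc₁ : 0 ≤ c₁) (hc₁1 : c₁ ≤ 1) (hc₂ : 0 ≤ c₂) (hc₂8 : c₂ ≤ 8)
    (hR₁ : |R₁| ≤ 4 * ι ^ 2) (hR₂ : |R₂| ≤ 2 * ι ^ 2) (hR₃ : |R₃| ≤ 4 * ι ^ 2) (hR₄ : |R₄| ≤ 2 * ι ^ 2)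
    (hw : |w| ≤ ω) (hv : |v| ≤ V) (hΔ : |Δ| ≤ 2 * Bσ) (hβ : 0 ≤ β) :
    |-R₁ + c₁ * (e * w ^ 2 + R₂) + c₂ * (e * v ^ 2 + R₃) - R₄ + β * Δ| ≤
      40 * ι ^ 2 + 2 * ω ^ 2 + 16 * V ^ 2 + 2 * β * Bσ := by
  have hw2 : w ^ 2 ≤ ω ^ 2 := by
    have := abs_nonneg w; nlinarith [sq_abs w, abs_nonneg w]
  have hv2 : v ^ 2 ≤ V ^ 2 := by
    have := abs_nonneg v; nlinarith [sq_abs v, abs_nonneg v]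
  have h2 : |c₁ * (e * w ^ 2 + R₂)| ≤ 2 * ω ^ 2 + 2 * ι ^ 2 := by
    rw [abs_mul, abs_of_nonneg hc₁]
    have hin : |e * w ^ 2 + R₂| ≤ 2 * ω ^ 2 + 2 * ι ^ 2 := by
      calc |e * w ^ 2 + R₂| ≤ |e * w ^ 2| + |R₂| := abs_add_le _ _
        _ ≤ 2 * ω ^ 2 + 2 * ι ^ 2 := by
            rw [abs_of_nonneg (by positivity)]; nlinarith
    calc c₁ * |e * w ^ 2 + R₂| ≤ 1 * |e * w ^ 2 + R₂| :=
          mul_le_mul_of_nonneg_right hc₁1 (abs_nonneg _)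
      _ ≤ 2 * ω ^ 2 + 2 * ι ^ 2 := by linarith
  have h3 : |c₂ * (e * v ^ 2 + R₃)| ≤ 16 * V ^ 2 + 32 * ι ^ 2 := by
    rw [abs_mul, abs_of_nonneg hc₂]
    have hin : |e * v ^ 2 + R₃| ≤ 2 * V ^ 2 + 4 * ι ^ 2 := by
      calc |e * v ^ 2 + R₃| ≤ |e * v ^ 2| + |R₃| := abs_add_le _ _
        _ ≤ 2 * V ^ 2 + 4 * ι ^ 2 := by
            rw [abs_of_nonneg (by positivity)]; nlinarith
    calc c₂ * |e * v ^ 2 + R₃| ≤ 8 * |e * v ^ 2 + R₃| :=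
          mul_le_mul_of_nonneg_right hc₂8 (abs_nonneg _)
      _ ≤ 16 * V ^ 2 + 32 * ι ^ 2 := by linarith
  have h5 : |β * Δ| ≤ 2 * β * Bσ := by
    rw [abs_mul, abs_of_nonneg hβ]; nlinarith
  calc |-R₁ + c₁ * (e * w ^ 2 + R₂) + c₂ * (e * v ^ 2 + R₃) - R₄ + β * Δ|
      ≤ |-R₁ + c₁ * (e * w ^ 2 + R₂) + c₂ * (e * v ^ 2 + R₃) - R₄| + |β * Δ| := abs_add_le _ _
    _ ≤ |-R₁ + c₁ * (e * w ^ 2 + R₂) + c₂ * (e * v ^ 2 + R₃)| + |R₄| + |β * Δ| := by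
        linarith [abs_sub (-R₁ + c₁ * (e * w ^ 2 + R₂) + c₂ * (e * v ^ 2 + R₃)) R₄]
    _ ≤ |-R₁ + c₁ * (e * w ^ 2 + R₂)| + |c₂ * (e * v ^ 2 + R₃)| + |R₄| + |β * Δ| := by
        linarith [abs_add_le (-R₁ + c₁ * (e * w ^ 2 + R₂)) (c₂ * (e * v ^ 2 + R₃))]
    _ ≤ |-R₁| + |c₁ * (e * w ^ 2 + R₂)| + |c₂ * (e * v ^ 2 + R₃)| + |R₄| + |β * Δ| := by
        linarith [abs_add_le (-R₁) (c₁ * (e * w ^ 2 + R₂))]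
    _ ≤ 4 * ι ^ 2 + (2 * ω ^ 2 + 2 * ι ^ 2) + (16 * V ^ 2 + 32 * ι ^ 2) + 2 * ι ^ 2 + 2 * β * Bσ := by
        rw [abs_neg]; linarith
    _ = 40 * ι ^ 2 + 2 * ω ^ 2 + 16 * V ^ 2 + 2 * β * Bσ := by ring

/-- Bookkeeping inequality for the trigger-side remainder `f₂` of the front block. [folklore] -/
theorem htcLC_f2_abs_le {c₁ R₅ R₆ R₇ R₈ u v w q ι ω V M β Bσ : ℝ}
    (hc₁ : 0 ≤ c₁) (hc₁1 : c₁ ≤ 1)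
    (hR₅ : |R₅| ≤ 2 * ι) (hR₆ : |R₆| ≤ 2 * ι) (hR₇ : |R₇| ≤ 2 * ι) (hR₈ : |R₈| ≤ 2 * ι)
    (hu : |u| ≤ M) (hv : |v| ≤ V) (hw : |w| ≤ ω) (hq : |q| ≤ Bσ) (hβ : 0 ≤ β) :
    |2 * u * R₅ + 2 * v * R₆ + 2 * u * R₇ + c₁ * (2 * w * R₈) + β * q| ≤
      8 * M * ι + 4 * V * ι + 4 * ω * ι + β * Bσ := by
  have hι : 0 ≤ ι := by linarith [abs_nonneg R₅]
  have h1 : |2 * u * R₅| ≤ 4 * M * ι := by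
    rw [abs_mul, abs_mul, abs_two]
    nlinarith [mul_le_mul hu hR₅ (abs_nonneg _) ((abs_nonneg _).trans hu), abs_nonneg u, abs_nonneg R₅]
  have h2 : |2 * v * R₆| ≤ 4 * V * ι := by
    rw [abs_mul, abs_mul, abs_two]
    nlinarith [mul_le_mul hv hR₆ (abs_nonneg _) ((abs_nonneg _).trans hv), abs_nonneg v, abs_nonneg R₆]
  have h3 : |2 * u * R₇| ≤ 4 * M * ι := by
    rw [abs_mul, abs_mul, abs_two]
    nlinarith [mul_le_mul hu hR₇ (abs_nonneg _) ((abs_nonneg _).trans hu), abs_nonneg u, abs_nonneg R₇]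
  have h4 : |c₁ * (2 * w * R₈)| ≤ 4 * ω * ι := by
    rw [abs_mul, abs_of_nonneg hc₁, abs_mul, abs_mul, abs_two]
    have hin : 2 * |w| * |R₈| ≤ 4 * ω * ι := by
      nlinarith [mul_le_mul hw hR₈ (abs_nonneg _) ((abs_nonneg _).trans hw), abs_nonneg w,
        abs_nonneg R₈]
    calc c₁ * (2 * |w| * |R₈|) ≤ 1 * (2 * |w| * |R₈|) :=
          mul_le_mul_of_nonneg_right hc₁1 (by positivity)
      _ ≤ 4 * ω * ι := by linarith
  have h5 : |β * q| ≤ β * Bσ := by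
    rw [abs_mul, abs_of_nonneg hβ]; exact mul_le_mul_of_nonneg_left hq hβ
  calc |2 * u * R₅ + 2 * v * R₆ + 2 * u * R₇ + c₁ * (2 * w * R₈) + β * q|
      ≤ |2 * u * R₅ + 2 * v * R₆ + 2 * u * R₇ + c₁ * (2 * w * R₈)| + |β * q| := abs_add_le _ _
    _ ≤ |2 * u * R₅ + 2 * v * R₆ + 2 * u * R₇| + |c₁ * (2 * w * R₈)| + |β * q| := by
        linarith [abs_add_le (2 * u * R₅ + 2 * v * R₆ + 2 * u * R₇) (c₁ * (2 * w * R₈))]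
    _ ≤ |2 * u * R₅ + 2 * v * R₆| + |2 * u * R₇| + |c₁ * (2 * w * R₈)| + |β * q| := by
        linarith [abs_add_le (2 * u * R₅ + 2 * v * R₆) (2 * u * R₇)]
    _ ≤ |2 * u * R₅| + |2 * v * R₆| + |2 * u * R₇| + |c₁ * (2 * w * R₈)| + |β * q| := by
        linarith [abs_add_le (2 * u * R₅) (2 * v * R₆)]
    _ ≤ 4 * M * ι + 4 * V * ι + 4 * M * ι + 4 * ω * ι + β * Bσ := by linarith
    _ = 8 * M * ι + 4 * V * ι + 4 * ω * ι + β * Bσ := by ring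

/-- **THE FRONT BLOCK OF AN EXACT LATTICE FLOW IS A FORCED ARC.** Setting of the module docstring:
`α₀` in normal form at `i₀` with (parity) for `i₁ ≠ i₀`, `g = e = d i₁ 0 > 0`, `|α₀| ≤ 1`; `S` solves the
exact equations of `α₀ + βσ` on `[0,T]` (within the segment); envelopes `M` (front block), `V` (upper
trigger), `ω` (wake trigger), `ι ≥ 0` (junk modes at shells `−1,0,1`), `B_σ` (the three `σ`-rows). Then
there are remainders `f₁, f₂` with `D′ = −2e·u² + f₁`, `u′ = e·D·u + f₂` on `[0,T]`
(`D = S_{i₀,0} − S_{i₀,1}`, `u = S_{i₁,0}`) and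
`|f₁|, |f₂| ≤ 40ι² + 2ω² + 16V² + 8Mι + 4Vι + 4ωι + 3βB_σ`. [this file] -/
theorem htcLC_front_block_forced (α₀ σ : Fin 4 → Fin 4 → Fin 4 → ℤ × ℤ × ℤ → ℝ) (i₀ i₁ : Fin 4)
    (d : Fin 4 → ℤ → ℝ) (hne : i₀ ≠ i₁)
    (hsym : IsSymmetricCoeff α₀) (hcanc : IsCancellingCoeff α₀)
    (hpure : ∀ X : Fin 4 → ℤ → ℝ → ℝ, (∀ i n t, i ≠ i₀ → X i n t = 0) →
      ∀ i n t, quadTerm 1 α₀ X i n t = 0)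
    (hsad : ∀ (Y : Fin 4 → ℤ → ℝ → ℝ) (i : Fin 4) (n : ℤ) (t : ℝ),
      quadTerm 1 α₀ (fun j m s => (fun j m (_ : ℝ) => if j = i₀ ∧ m = 0 then (1 : ℝ) else 0) j m s +
          Y j m s) i n t -
        quadTerm 1 α₀ (fun j m (_ : ℝ) => if j = i₀ ∧ m = 0 then (1 : ℝ) else 0) i n t -
        quadTerm 1 α₀ Y i n t = d i n * Y i n t)
    (hpar : ∀ (j₁ j₂ j₃ : Fin 4) (μ : ℤ × ℤ × ℤ),
      Xor (Xor (j₁ = i₁) (j₂ = i₁)) (j₃ = i₁) → α₀ j₁ j₂ j₃ μ = 0)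
    (hα1 : ∀ a b c μ, |α₀ a b c μ| ≤ 1)
    (hg : α₀ i₁ i₁ i₀ (0, 0, 1) = d i₁ 0) (he : 0 < d i₁ 0)
    (β : ℝ) (hβ : 0 ≤ β) (S : Fin 4 → ℤ → ℝ → ℝ) {T : ℝ} (hT : 0 ≤ T)
    (hS : ∀ i k, ∀ t ∈ Icc 0 T, HasDerivWithinAt (S i k)
      (quadTerm 1 α₀ S i k t + β * quadTerm 1 σ S i k t) (Icc 0 T) t)
    {M V ι ω Bσ : ℝ} (hι0 : 0 ≤ ι)
    (hM : ∀ t ∈ Icc 0 T, |S i₀ 0 t - S i₀ 1 t| ≤ M ∧ |S i₁ 0 t| ≤ M)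
    (hV : ∀ t ∈ Icc 0 T, |S i₁ 1 t| ≤ V) (hω : ∀ t ∈ Icc 0 T, |S i₁ (-1) t| ≤ ω)
    (hι : ∀ t ∈ Icc 0 T, ∀ a, a ≠ i₀ → a ≠ i₁ → |S a 0 t| ≤ ι ∧ |S a 1 t| ≤ ι ∧ |S a (-1) t| ≤ ι)
    (hBσ : ∀ t ∈ Icc 0 T, |quadTerm 1 σ S i₀ 0 t| ≤ Bσ ∧ |quadTerm 1 σ S i₀ 1 t| ≤ Bσ ∧
      |quadTerm 1 σ S i₁ 0 t| ≤ Bσ) :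
    ∃ f₁ f₂ : ℝ → ℝ,
      (∀ t ∈ Icc 0 T, HasDerivWithinAt (fun t => S i₀ 0 t - S i₀ 1 t)
        (-(2 * d i₁ 0 * S i₁ 0 t ^ 2) + f₁ t) (Icc 0 T) t) ∧
      (∀ t ∈ Icc 0 T, HasDerivWithinAt (S i₁ 0)
        (d i₁ 0 * (S i₀ 0 t - S i₀ 1 t) * S i₁ 0 t + f₂ t) (Icc 0 T) t) ∧
      (∀ t ∈ Icc 0 T, |f₁ t| ≤
        40 * ι ^ 2 + 2 * ω ^ 2 + 16 * V ^ 2 + 8 * M * ι + 4 * V * ι + 4 * ω * ι + 3 * β * Bσ) ∧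
      (∀ t ∈ Icc 0 T, |f₂ t| ≤
        40 * ι ^ 2 + 2 * ω ^ 2 + 16 * V ^ 2 + 8 * M * ι + 4 * V * ι + 4 * ω * ι + 3 * β * Bσ) := by
  -- normal-form facts
  obtain ⟨nf1, -, -, nf4, -, -, nf7, -, -⟩ :=
    HeteroclinicTriggerChain.stub_normal_form α₀ i₀ d hsym hcanc hpure hsad
  obtain ⟨hc0, hc1, hc2, hc3⟩ := htcTR_trigger_carrier_coefficients α₀ i₀ i₁ d hsym hcanc hpure hsad
  have m001 : ((0 : ℤ), (0 : ℤ), (1 : ℤ)) ∈ shiftSet := by decide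
  have hg0 : α₀ i₀ i₀ i₀ (0, 0, 1) = 0 := nf1 i₀ (0, 0, 1) m001
  have hd0 : d i₀ 0 = 0 := nf7 0
  have hpar3 : ∀ μ : ℤ × ℤ × ℤ, α₀ i₁ i₁ i₁ μ = 0 := fun μ => hpar i₁ i₁ i₁ μ (by simp [Xor])
  have he2 : d i₁ 0 ≤ 2 := by
    rw [nf4 i₁]; have := (abs_le.1 (hα1 i₀ i₁ i₁ (0, 0, 0))).2; linarith
  have hda : ∀ a, |d a 0| ≤ 2 := fun a => by
    rw [nf4 a, abs_mul, abs_two]; linarith [hα1 i₀ a a (0, 0, 0)]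
  -- the numerical gains
  have hc₁0 : (0 : ℝ) ≤ (2 : ℝ) ^ (-((5 : ℝ) / 2)) := Real.rpow_nonneg (by norm_num) _
  have hc₁1 : (2 : ℝ) ^ (-((5 : ℝ) / 2)) ≤ 1 :=
    Real.rpow_le_one_of_one_le_of_nonpos (by norm_num) (by norm_num)
  have hc₂0 : (0 : ℝ) ≤ (2 : ℝ) ^ ((5 : ℝ) / 2) := Real.rpow_nonneg (by norm_num) _
  have hc₂8 : (2 : ℝ) ^ ((5 : ℝ) / 2) ≤ 8 := by
    have h1 : (2 : ℝ) ^ ((5 : ℝ) / 2) ≤ (2 : ℝ) ^ (3 : ℝ) :=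
      Real.rpow_le_rpow_of_exponent_le (by norm_num) (by norm_num)
    have h2 : (2 : ℝ) ^ (3 : ℝ) = 8 := by
      rw [show (3 : ℝ) = ((3 : ℕ) : ℝ) by norm_num, Real.rpow_natCast]; norm_num
    linarith
  -- nonnegativity of the envelopes
  have hM0 : 0 ≤ M := (abs_nonneg _).trans (hM 0 ⟨le_rfl, hT⟩).2
  have hV0 : 0 ≤ V := (abs_nonneg _).trans (hV 0 ⟨le_rfl, hT⟩)
  have hω0 : 0 ≤ ω := (abs_nonneg _).trans (hω 0 ⟨le_rfl, hT⟩)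
  have hB0 : 0 ≤ Bσ := (abs_nonneg _).trans (hBσ 0 ⟨le_rfl, hT⟩).1
  -- pointwise junk bounds
  have hsq : ∀ {z : ℝ}, |z| ≤ ι → z ^ 2 ≤ ι ^ 2 := fun {z} hz => by
    have := abs_nonneg z; nlinarith [sq_abs z]
  have hjd : ∀ (a : Fin 4) (z : ℝ), |z| ≤ ι → |d a 0 * z ^ 2| ≤ 2 * ι ^ 2 := fun a z hz => by
    rw [abs_mul, abs_of_nonneg (sq_nonneg z)]
    exact mul_le_mul (hda a) (hsq hz) (sq_nonneg _) (by norm_num)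
  have hjg : ∀ (a : Fin 4) (z : ℝ), |z| ≤ ι → |α₀ a a i₀ (0, 0, 1) * z ^ 2| ≤ ι ^ 2 := fun a z hz => by
    rw [abs_mul, abs_of_nonneg (sq_nonneg z)]
    calc |α₀ a a i₀ (0, 0, 1)| * z ^ 2 ≤ 1 * ι ^ 2 :=
        mul_le_mul (hα1 a a i₀ _) (hsq hz) (sq_nonneg _) (by norm_num)
      _ = ι ^ 2 := one_mul _
  have hjb : ∀ (c z : ℝ), |c| ≤ 1 → |z| ≤ ι → |c * z| ≤ ι := fun c z hc hz => by
    rw [abs_mul]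
    calc |c| * |z| ≤ 1 * ι := mul_le_mul hc hz (abs_nonneg _) (by norm_num)
      _ = ι := one_mul _
  -- the remainders
  refine ⟨fun t => (quadTerm 1 α₀ S i₀ 0 t + β * quadTerm 1 σ S i₀ 0 t) -
      (quadTerm 1 α₀ S i₀ 1 t + β * quadTerm 1 σ S i₀ 1 t) + 2 * d i₁ 0 * S i₁ 0 t ^ 2,
    fun t => (quadTerm 1 α₀ S i₁ 0 t + β * quadTerm 1 σ S i₁ 0 t) -
      d i₁ 0 * (S i₀ 0 t - S i₀ 1 t) * S i₁ 0 t, ?_, ?_, ?_, ?_⟩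
  · intro t ht
    exact ((hS i₀ 0 t ht).sub (hS i₀ 1 t ht)).congr_deriv (by ring)
  · intro t ht
    exact (hS i₁ 0 t ht).congr_deriv (by ring)
  · -- the carrier-side remainder
    intro t ht
    have hx := htcCR_quadTerm_carrier_zero α₀ i₀ d hsym hcanc hpure hsad S t
    have hy := htcCR_quadTerm_carrier_one α₀ i₀ d hsym hcanc hpure hsad S t
    have hjunk0 : ∀ a, a ≠ i₀ → a ≠ i₁ → |S a 0 t| ≤ ι := fun a h0 h1 => (hι t ht a h0 h1).1
    have hjunk1 : ∀ a, a ≠ i₀ → a ≠ i₁ → |S a 1 t| ≤ ι := fun a h0 h1 => (hι t ht a h0 h1).2.1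
    have hjunkm : ∀ a, a ≠ i₀ → a ≠ i₁ → |S a (-1) t| ≤ ι := fun a h0 h1 => (hι t ht a h0 h1).2.2
    -- the four junk remainders
    set R₁ : ℝ := ∑ a, d a 0 * S a 0 t ^ 2 - d i₁ 0 * S i₁ 0 t ^ 2 with hR₁
    set R₂ : ℝ := ∑ a, α₀ a a i₀ (0, 0, 1) * S a (-1) t ^ 2 - d i₁ 0 * S i₁ (-1) t ^ 2 with hR₂
    set R₃ : ℝ := ∑ a, d a 0 * S a 1 t ^ 2 - d i₁ 0 * S i₁ 1 t ^ 2 with hR₃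
    set R₄ : ℝ := ∑ a, α₀ a a i₀ (0, 0, 1) * S a 0 t ^ 2 - d i₁ 0 * S i₁ 0 t ^ 2 with hR₄
    have hB₁ : |R₁| ≤ 4 * ι ^ 2 := by
      have h := htcLC_sum_split (fun a => d a 0 * S a 0 t ^ 2) hne (B := 2 * ι ^ 2)
        (fun a h0 h1 => hjd a _ (hjunk0 a h0 h1))
      have key : R₁ = ∑ a, d a 0 * S a 0 t ^ 2 - d i₀ 0 * S i₀ 0 t ^ 2 - d i₁ 0 * S i₁ 0 t ^ 2 := by
        rw [hR₁, hd0]; ring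
      rw [key]; linarith
    have hB₂ : |R₂| ≤ 2 * ι ^ 2 := by
      have h := htcLC_sum_split (fun a => α₀ a a i₀ (0, 0, 1) * S a (-1) t ^ 2) hne (B := ι ^ 2)
        (fun a h0 h1 => hjg a _ (hjunkm a h0 h1))
      have key : R₂ = ∑ a, α₀ a a i₀ (0, 0, 1) * S a (-1) t ^ 2 -
          α₀ i₀ i₀ i₀ (0, 0, 1) * S i₀ (-1) t ^ 2 - α₀ i₁ i₁ i₀ (0, 0, 1) * S i₁ (-1) t ^ 2 := by
        rw [hR₂, hg0, hg]; ring
      rw [key]; linarith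
    have hB₃ : |R₃| ≤ 4 * ι ^ 2 := by
      have h := htcLC_sum_split (fun a => d a 0 * S a 1 t ^ 2) hne (B := 2 * ι ^ 2)
        (fun a h0 h1 => hjd a _ (hjunk1 a h0 h1))
      have key : R₃ = ∑ a, d a 0 * S a 1 t ^ 2 - d i₀ 0 * S i₀ 1 t ^ 2 - d i₁ 0 * S i₁ 1 t ^ 2 := by
        rw [hR₃, hd0]; ring
      rw [key]; linarith
    have hB₄ : |R₄| ≤ 2 * ι ^ 2 := by
      have h := htcLC_sum_split (fun a => α₀ a a i₀ (0, 0, 1) * S a 0 t ^ 2) hne (B := ι ^ 2)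
        (fun a h0 h1 => hjg a _ (hjunk0 a h0 h1))
      have key : R₄ = ∑ a, α₀ a a i₀ (0, 0, 1) * S a 0 t ^ 2 -
          α₀ i₀ i₀ i₀ (0, 0, 1) * S i₀ 0 t ^ 2 - α₀ i₁ i₁ i₀ (0, 0, 1) * S i₁ 0 t ^ 2 := by
        rw [hR₄, hg0, hg]; ring
      rw [key]; linarith
    have hΔ : |quadTerm 1 σ S i₀ 0 t - quadTerm 1 σ S i₀ 1 t| ≤ 2 * Bσ := by
      calc |quadTerm 1 σ S i₀ 0 t - quadTerm 1 σ S i₀ 1 t|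
          ≤ |quadTerm 1 σ S i₀ 0 t| + |quadTerm 1 σ S i₀ 1 t| := abs_sub _ _
        _ ≤ 2 * Bσ := by linarith [(hBσ t ht).1, (hBσ t ht).2.1]
    have heq : (quadTerm 1 α₀ S i₀ 0 t + β * quadTerm 1 σ S i₀ 0 t) -
        (quadTerm 1 α₀ S i₀ 1 t + β * quadTerm 1 σ S i₀ 1 t) + 2 * d i₁ 0 * S i₁ 0 t ^ 2 =
        -R₁ + (2 : ℝ) ^ (-((5 : ℝ) / 2)) * (d i₁ 0 * S i₁ (-1) t ^ 2 + R₂) +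
          (2 : ℝ) ^ ((5 : ℝ) / 2) * (d i₁ 0 * S i₁ 1 t ^ 2 + R₃) - R₄ +
          β * (quadTerm 1 σ S i₀ 0 t - quadTerm 1 σ S i₀ 1 t) := by
      rw [hx, hy, hR₁, hR₂, hR₃, hR₄]; ring
    show |(quadTerm 1 α₀ S i₀ 0 t + β * quadTerm 1 σ S i₀ 0 t) -
        (quadTerm 1 α₀ S i₀ 1 t + β * quadTerm 1 σ S i₀ 1 t) + 2 * d i₁ 0 * S i₁ 0 t ^ 2| ≤ _
    rw [heq]
    have h := htcLC_f1_abs_le he.le he2 hc₁0 hc₁1 hc₂0 hc₂8 hB₁ hB₂ hB₃ hB₄ (hω t ht) (hV t ht)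
      hΔ hβ
    have hrest : 0 ≤ 8 * M * ι + 4 * V * ι + 4 * ω * ι + β * Bσ := by positivity
    linarith
  · -- the trigger-side remainder
    intro t ht
    have hu := htcTR_quadTerm_trigger α₀ i₁ hsym hpar S 0 t
    have g0 : (1 + 1 : ℝ) ^ ((5 : ℝ) * ((0 : ℤ) : ℝ) / 2) = 1 := by simp
    have g1 : (1 + 1 : ℝ) ^ ((5 : ℝ) * (((0 : ℤ) : ℝ) - 1) / 2) = (2 : ℝ) ^ (-((5 : ℝ) / 2)) := by
      norm_num
    rw [g0, g1, one_mul, zero_add, zero_sub] at hu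
    have hjunk0 : ∀ a, a ≠ i₀ → a ≠ i₁ → |S a 0 t| ≤ ι := fun a h0 h1 => (hι t ht a h0 h1).1
    have hjunk1 : ∀ a, a ≠ i₀ → a ≠ i₁ → |S a 1 t| ≤ ι := fun a h0 h1 => (hι t ht a h0 h1).2.1
    have hjunkm : ∀ a, a ≠ i₀ → a ≠ i₁ → |S a (-1) t| ≤ ι := fun a h0 h1 => (hι t ht a h0 h1).2.2
    set R₅ : ℝ := ∑ b, α₀ i₁ b i₁ (0, 0, 0) * S b 0 t - d i₁ 0 / 2 * S i₀ 0 t with hR₅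
    set R₆ : ℝ := ∑ b, α₀ i₁ b i₁ (1, 0, 0) * S b 0 t with hR₆
    set R₇ : ℝ := ∑ b, α₀ b i₁ i₁ (1, 0, 0) * S b 1 t + d i₁ 0 / 2 * S i₀ 1 t with hR₇
    set R₈ : ℝ := ∑ b, α₀ i₁ b i₁ (0, 0, 1) * S b (-1) t with hR₈
    have hB₅ : |R₅| ≤ 2 * ι := by
      have h := htcLC_sum_split (fun b => α₀ i₁ b i₁ (0, 0, 0) * S b 0 t) hne (B := ι)
        (fun a h0 h1 => hjb _ _ (hα1 _ _ _ _) (hjunk0 a h0 h1))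
      have key : R₅ = ∑ b, α₀ i₁ b i₁ (0, 0, 0) * S b 0 t - α₀ i₁ i₀ i₁ (0, 0, 0) * S i₀ 0 t -
          α₀ i₁ i₁ i₁ (0, 0, 0) * S i₁ 0 t := by
        rw [hR₅, hc0, hpar3]; ring
      rw [key]; exact h
    have hB₆ : |R₆| ≤ 2 * ι := by
      have h := htcLC_sum_split (fun b => α₀ i₁ b i₁ (1, 0, 0) * S b 0 t) hne (B := ι)
        (fun a h0 h1 => hjb _ _ (hα1 _ _ _ _) (hjunk0 a h0 h1))
      have key : R₆ = ∑ b, α₀ i₁ b i₁ (1, 0, 0) * S b 0 t - α₀ i₁ i₀ i₁ (1, 0, 0) * S i₀ 0 t -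
          α₀ i₁ i₁ i₁ (1, 0, 0) * S i₁ 0 t := by
        rw [hR₆, hc1, hpar3]; ring
      rw [key]; exact h
    have hB₇ : |R₇| ≤ 2 * ι := by
      have h := htcLC_sum_split (fun b => α₀ b i₁ i₁ (1, 0, 0) * S b 1 t) hne (B := ι)
        (fun a h0 h1 => hjb _ _ (hα1 _ _ _ _) (hjunk1 a h0 h1))
      have key : R₇ = ∑ b, α₀ b i₁ i₁ (1, 0, 0) * S b 1 t - α₀ i₀ i₁ i₁ (1, 0, 0) * S i₀ 1 t -
          α₀ i₁ i₁ i₁ (1, 0, 0) * S i₁ 1 t := by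
        rw [hR₇, hc2, hg, hpar3]; ring
      rw [key]; exact h
    have hB₈ : |R₈| ≤ 2 * ι := by
      have h := htcLC_sum_split (fun b => α₀ i₁ b i₁ (0, 0, 1) * S b (-1) t) hne (B := ι)
        (fun a h0 h1 => hjb _ _ (hα1 _ _ _ _) (hjunkm a h0 h1))
      have key : R₈ = ∑ b, α₀ i₁ b i₁ (0, 0, 1) * S b (-1) t - α₀ i₁ i₀ i₁ (0, 0, 1) * S i₀ (-1) t -
          α₀ i₁ i₁ i₁ (0, 0, 1) * S i₁ (-1) t := by
        rw [hR₈, hc3, hpar3]; ring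
      rw [key]; exact h
    have heq : (quadTerm 1 α₀ S i₁ 0 t + β * quadTerm 1 σ S i₁ 0 t) -
        d i₁ 0 * (S i₀ 0 t - S i₀ 1 t) * S i₁ 0 t =
        2 * S i₁ 0 t * R₅ + 2 * S i₁ 1 t * R₆ + 2 * S i₁ 0 t * R₇ +
          (2 : ℝ) ^ (-((5 : ℝ) / 2)) * (2 * S i₁ (-1) t * R₈) + β * quadTerm 1 σ S i₁ 0 t := by
      rw [hu, hR₅, hR₆, hR₇, hR₈]; ring
    show |(quadTerm 1 α₀ S i₁ 0 t + β * quadTerm 1 σ S i₁ 0 t) -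
        d i₁ 0 * (S i₀ 0 t - S i₀ 1 t) * S i₁ 0 t| ≤ _
    rw [heq]
    have h := htcLC_f2_abs_le hc₁0 hc₁1 hB₅ hB₆ hB₇ hB₈ (hM t ht).2 (hV t ht) (hω t ht)
      (hBσ t ht).2.2 hβ
    have hrest : 0 ≤ 40 * ι ^ 2 + 2 * ω ^ 2 + 16 * V ^ 2 + 2 * β * Bσ := by positivity
    linarith

/-- **CAPTURE ON THE LATTICE.** In the setting of `htcLC_front_block_forced`, write `e = d i₁ 0`,
`D = S_{i₀,0} − S_{i₀,1}`, `u = S_{i₁,0}` and `φ = 40ι² + 2ω² + 16V² + 8Mι + 4Vι + 4ωι + 3βB_σ`. If the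
trigger is ignited and the capture level fits inside the drifting radius — `2m + 6MφT ≤ 2u(0)²`,
`L² + 2m + 6MφT ≤ D(0)² + 2u(0)²`, `φ < 2em` — and the window is long enough,
`(D(0)+L)/(2em−φ) ≤ T`, then the receiver shell captures the energy of the carrier shell:
`S_{i₀,0}(t) − S_{i₀,1}(t) ≤ −L` for some `t ≤ max 0 ((D(0)+L)/(2em−φ))`. [this file] -/
theorem htcLC_lattice_capture (α₀ σ : Fin 4 → Fin 4 → Fin 4 → ℤ × ℤ × ℤ → ℝ) (i₀ i₁ : Fin 4)
    (d : Fin 4 → ℤ → ℝ) (hne : i₀ ≠ i₁)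
    (hsym : IsSymmetricCoeff α₀) (hcanc : IsCancellingCoeff α₀)
    (hpure : ∀ X : Fin 4 → ℤ → ℝ → ℝ, (∀ i n t, i ≠ i₀ → X i n t = 0) →
      ∀ i n t, quadTerm 1 α₀ X i n t = 0)
    (hsad : ∀ (Y : Fin 4 → ℤ → ℝ → ℝ) (i : Fin 4) (n : ℤ) (t : ℝ),
      quadTerm 1 α₀ (fun j m s => (fun j m (_ : ℝ) => if j = i₀ ∧ m = 0 then (1 : ℝ) else 0) j m s +
          Y j m s) i n t -
        quadTerm 1 α₀ (fun j m (_ : ℝ) => if j = i₀ ∧ m = 0 then (1 : ℝ) else 0) i n t -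
        quadTerm 1 α₀ Y i n t = d i n * Y i n t)
    (hpar : ∀ (j₁ j₂ j₃ : Fin 4) (μ : ℤ × ℤ × ℤ),
      Xor (Xor (j₁ = i₁) (j₂ = i₁)) (j₃ = i₁) → α₀ j₁ j₂ j₃ μ = 0)
    (hα1 : ∀ a b c μ, |α₀ a b c μ| ≤ 1)
    (hg : α₀ i₁ i₁ i₀ (0, 0, 1) = d i₁ 0) (he : 0 < d i₁ 0)
    (β : ℝ) (hβ : 0 ≤ β) (S : Fin 4 → ℤ → ℝ → ℝ) {T : ℝ} (hT : 0 ≤ T)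
    (hS : ∀ i k, ∀ t ∈ Icc 0 T, HasDerivWithinAt (S i k)
      (quadTerm 1 α₀ S i k t + β * quadTerm 1 σ S i k t) (Icc 0 T) t)
    {M V ι ω Bσ : ℝ} (hι0 : 0 ≤ ι)
    (hM : ∀ t ∈ Icc 0 T, |S i₀ 0 t - S i₀ 1 t| ≤ M ∧ |S i₁ 0 t| ≤ M)
    (hV : ∀ t ∈ Icc 0 T, |S i₁ 1 t| ≤ V) (hω : ∀ t ∈ Icc 0 T, |S i₁ (-1) t| ≤ ω)
    (hι : ∀ t ∈ Icc 0 T, ∀ a, a ≠ i₀ → a ≠ i₁ → |S a 0 t| ≤ ι ∧ |S a 1 t| ≤ ι ∧ |S a (-1) t| ≤ ι)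
    (hBσ : ∀ t ∈ Icc 0 T, |quadTerm 1 σ S i₀ 0 t| ≤ Bσ ∧ |quadTerm 1 σ S i₀ 1 t| ≤ Bσ ∧
      |quadTerm 1 σ S i₁ 0 t| ≤ Bσ)
    {φ m L : ℝ}
    (hφ : φ = 40 * ι ^ 2 + 2 * ω ^ 2 + 16 * V ^ 2 + 8 * M * ι + 4 * V * ι + 4 * ω * ι + 3 * β * Bσ)
    (hφm : φ < 2 * d i₁ 0 * m) (hu0 : 2 * m + 6 * M * φ * T ≤ 2 * S i₁ 0 0 ^ 2)
    (hL : L ^ 2 + 2 * m + 6 * M * φ * T ≤ (S i₀ 0 0 - S i₀ 1 0) ^ 2 + 2 * S i₁ 0 0 ^ 2)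
    (hTT : ((S i₀ 0 0 - S i₀ 1 0) + L) / (2 * d i₁ 0 * m - φ) ≤ T) :
    ∃ t ∈ Icc 0 (max 0 (((S i₀ 0 0 - S i₀ 1 0) + L) / (2 * d i₁ 0 * m - φ))),
      S i₀ 0 t - S i₀ 1 t ≤ -L := by
  obtain ⟨f₁, f₂, hD, hu, hf₁, hf₂⟩ := htcLC_front_block_forced α₀ σ i₀ i₁ d hne hsym hcanc hpure
    hsad hpar hα1 hg he β hβ S hT hS hι0 hM hV hω hι hBσ
  have hf₁' : ∀ t ∈ Icc 0 T, |f₁ t| ≤ φ := fun t ht => by rw [hφ]; exact hf₁ t ht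
  have hf₂' : ∀ t ∈ Icc 0 T, |f₂ t| ≤ φ := fun t ht => by rw [hφ]; exact hf₂ t ht
  exact heteroclinicTriggerChain_forcedArcOn_capture (D := fun t => S i₀ 0 t - S i₀ 1 t)
    (u := S i₁ 0) he hT hD hu hf₁' hf₂' (fun t ht => (hM t ht).1) (fun t ht => (hM t ht).2)
    hφm hu0 hL hTT

end Summit.NavierStokesRegularity.NavierStokesRegularity.Theorems

end
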